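import Mathlib
import Summits.ValiantsHypothesis.ValiantsHypothesis.Theses.IntegralOrbits

/-!
# `HeightToSize` — height is free up to size for affine determinantal expressions over `ℤ`

Route `route-ValiantsHypothesis-IntegralOrbits`, item `stmt-ValiantsHypothesis-7681` (support).

**Statement.** There is an absolute constant `c` (we take `c = 2`) such that every `m × m` matrix
`A` of affine forms over `ℤ` in the variables `σ`, all of whose coefficients are bounded by `2 ^ h`
in absolute value, can be replaced by a matrix `B` of affine forms of size
`m' ≤ (m + #σ + h + 2) ^ c` with ALL coefficients in `{-1, 0, 1}` and `det B = det A`.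

**Proof (block gadget, no branching programs).** We do not go through ABPs.  Instead we realise
the linear-algebraic content of "binary expansion of the constants" directly with block matrices.
Call a matrix *small* if its entries are affine forms with coefficients in `{-1, 0, 1}`.
A *gadget* for a matrix `H` is a quadruple `(X, U, V, D)` with `X * D = U`, `X * V = H`,
`det D = 1` and `U, V, D` small (`X` is arbitrary).  Given a gadget for `A`,
`fromBlocks 1 X 0 1 * fromBlocks A 0 (-V) D = fromBlocks 0 U (-V) D =: B₀`, so `B₀` is small and
`det B₀ = det A · det D = det A` (`Matrix.det_fromBlocks_zero₂₁/₁₂`).  Gadgets are built by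
induction on the height `h`: for `h = 0` take `(1, 1, A, 1)`; for `h + 1` write coefficientwise
`A = A₀ + A₁ + A₁` with `A₀ = A mod 2` (small) and `A₁ = A div 2` (height `h`), take a gadget
`(X₁, U₁, V₁, D₁)` for `A₁` and set
`X = [X₁ + X₁ | 1 | 1]`, `U = [U₁ | 1 | 1]`, `V = [V₁ ; 0 ; A₀]`,
`D = fromBlocks (fromBlocks D₁ 0 (-U₁) 1) 0 0 1` (the "doubling by a copied output" trick keeps every
entry in `{-1, 0, 1}`).  Each level adds `2m` auxiliary indices, so `B₀` has size
`m + m (2h + 1) = 2m(h + 1) ≤ (m + h + 2) ^ 2`; finally `B₀` is reindexed to `Fin m'`.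

References: Valiant 1979 (universality of the determinant), Mahajan–Vinay 1997; the gadget is the
matrix form of the series–parallel binary-expansion gadget for ABP edge constants.
-/

-- `Summit.<Summit>.<Problem>` repeats `ValiantsHypothesis` by the tree's layout convention (D-0017).
set_option linter.dupNamespace false

namespace Summit.ValiantsHypothesis.ValiantsHypothesis.Theorems

namespace HeightToSizeProof

open MvPolynomial Matrix

variable {σ : Type}

/-- Halving a coefficient of height `h + 1` gives height `h`. -/
theorem abs_ediv_two_le {c : ℤ} {h : ℕ} (hc : |c| ≤ 2 ^ (h + 1)) : |c / 2| ≤ 2 ^ h := by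
  rw [abs_le] at hc ⊢
  rw [pow_succ] at hc
  omega

/-- A remainder mod `2` lies in `{0, 1}`. -/
theorem abs_emod_two_le (c : ℤ) : |c % 2| ≤ 1 := by
  rw [abs_le]; omega

/-- Coefficientwise `div 2` and `mod 2` of an integer polynomial, without raising the total
degree. -/
theorem exists_halve (p : MvPolynomial σ ℤ) :
    ∃ q r : MvPolynomial σ ℤ, (∀ s, q.coeff s = p.coeff s / 2) ∧ (∀ s, r.coeff s = p.coeff s % 2) ∧
      q.totalDegree ≤ p.totalDegree ∧ r.totalDegree ≤ p.totalDegree := by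
  classical
  refine ⟨∑ t ∈ p.support, monomial t (p.coeff t / 2),
    ∑ t ∈ p.support, monomial t (p.coeff t % 2), fun s => ?_, fun s => ?_, ?_, ?_⟩
  · simp only [coeff_sum, coeff_monomial, Finset.sum_ite_eq']
    split_ifs with h
    · rfl
    · rw [notMem_support_iff.mp h]; simp
  · simp only [coeff_sum, coeff_monomial, Finset.sum_ite_eq']
    split_ifs with h
    · rfl
    · rw [notMem_support_iff.mp h]; simp
  · exact totalDegree_finsetSum_le fun t ht =>
      (totalDegree_monomial_le _ _).trans (le_totalDegree ht)
  · exact totalDegree_finsetSum_le fun t ht =>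
      (totalDegree_monomial_le _ _).trans (le_totalDegree ht)

/-- Matrix form of `exists_halve`: `H = H₀ + H₁ + H₁` coefficientwise. -/
theorem exists_matrix_halve {n : Type} (H : Matrix n n (MvPolynomial σ ℤ)) :
    ∃ H₁ H₀ : Matrix n n (MvPolynomial σ ℤ), H = H₀ + H₁ + H₁ ∧
      (∀ i j s, (H₁ i j).coeff s = (H i j).coeff s / 2) ∧
      (∀ i j s, (H₀ i j).coeff s = (H i j).coeff s % 2) ∧
      (∀ i j, (H₁ i j).totalDegree ≤ (H i j).totalDegree) ∧
      (∀ i j, (H₀ i j).totalDegree ≤ (H i j).totalDegree) := by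
  choose q r hq hr hqd hrd using fun i j => exists_halve (H i j)
  refine ⟨Matrix.of q, Matrix.of r, ?_, fun i j s => by simpa using hq i j s,
    fun i j s => by simpa using hr i j s, fun i j => by simpa using hqd i j,
    fun i j => by simpa using hrd i j⟩
  ext i j s
  simp only [Matrix.add_apply, Matrix.of_apply, coeff_add, hq, hr]
  omega

/-- Entries of the identity matrix are affine (indeed constant). -/
theorem totalDegree_one_apply_le {ι : Type} [DecidableEq ι] (i j : ι) :
    ((1 : Matrix ι ι (MvPolynomial σ ℤ)) i j).totalDegree ≤ 1 := by
  rw [Matrix.one_apply]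
  split_ifs <;> simp

/-- Entries of the identity matrix have coefficients in `{0, 1}`. -/
theorem abs_coeff_one_apply_le {ι : Type} [DecidableEq ι] (i j : ι) (s : σ →₀ ℕ) :
    |((1 : Matrix ι ι (MvPolynomial σ ℤ)) i j).coeff s| ≤ 1 := by
  classical
  rw [Matrix.one_apply]
  split_ifs
  · rw [coeff_one]
    split_ifs <;> simp
  · simp

/-- **The gadget.**  For every square matrix `H` of affine forms of height `h` there are
`X U : n × ι`, `V : ι × n`, `D : ι × ι` with `#ι = #n · (2h + 1)`, `X * D = U`, `X * V = H`,
`det D = 1`, and `U, V, D` affine with coefficients in `{-1, 0, 1}`. -/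
theorem exists_gadget {n : Type} [Fintype n] [DecidableEq n] (h : ℕ) :
    ∀ H : Matrix n n (MvPolynomial σ ℤ), (∀ i j, (H i j).totalDegree ≤ 1) →
      (∀ i j s, |(H i j).coeff s| ≤ (2 : ℤ) ^ h) →
      ∃ (ι : Type) (_ : Fintype ι) (_ : DecidableEq ι) (X U : Matrix n ι (MvPolynomial σ ℤ))
        (V : Matrix ι n (MvPolynomial σ ℤ)) (D : Matrix ι ι (MvPolynomial σ ℤ)),
        Fintype.card ι = Fintype.card n * (2 * h + 1) ∧ X * D = U ∧ X * V = H ∧ D.det = 1 ∧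
        (∀ i j, (U i j).totalDegree ≤ 1) ∧ (∀ i j s, |(U i j).coeff s| ≤ 1) ∧
        (∀ i j, (V i j).totalDegree ≤ 1) ∧ (∀ i j s, |(V i j).coeff s| ≤ 1) ∧
        (∀ i j, (D i j).totalDegree ≤ 1) ∧ (∀ i j s, |(D i j).coeff s| ≤ 1) := by
  induction h with
  | zero =>
    intro H hd hc
    refine ⟨n, inferInstance, inferInstance, 1, 1, H, 1, by simp, Matrix.mul_one _,
      Matrix.one_mul _, det_one, totalDegree_one_apply_le, abs_coeff_one_apply_le, hd,
      fun i j s => by simpa using hc i j s, totalDegree_one_apply_le, abs_coeff_one_apply_le⟩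
  | succ h ih =>
    intro H hd hc
    obtain ⟨H₁, H₀, hH, h₁c, h₀c, h₁d, h₀d⟩ := exists_matrix_halve H
    obtain ⟨ι, _, _, X₁, U₁, V₁, D₁, hcard, hXD, hXV, hdet, hUd, hUc, hVd, hVc, hDd, hDc⟩ :=
      ih H₁ (fun i j => (h₁d i j).trans (hd i j))
        (fun i j s => by rw [h₁c]; exact abs_ediv_two_le (hc i j s))
    refine ⟨(ι ⊕ n) ⊕ n, inferInstance, inferInstance,
      fromCols (fromCols (X₁ + X₁) (1 : Matrix n n (MvPolynomial σ ℤ)))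
        (1 : Matrix n n (MvPolynomial σ ℤ)),
      fromCols (fromCols U₁ (1 : Matrix n n (MvPolynomial σ ℤ))) (1 : Matrix n n (MvPolynomial σ ℤ)),
      fromRows (fromRows V₁ (0 : Matrix n n (MvPolynomial σ ℤ))) H₀,
      fromBlocks (fromBlocks D₁ 0 (-U₁) 1) 0 0 1, ?_, ?_, ?_, ?_, ?_, ?_, ?_, ?_, ?_, ?_⟩
    · simp only [Fintype.card_sum, hcard]; ring
    · rw [fromCols_mul_fromBlocks, fromCols_mul_fromBlocks]
      simp only [Matrix.mul_zero, add_zero, zero_add, Matrix.one_mul, Matrix.add_mul, hXD,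
        add_neg_cancel_right]
    · rw [fromCols_mul_fromRows, fromCols_mul_fromRows]
      simp only [Matrix.add_mul, hXV, Matrix.mul_zero, add_zero, Matrix.one_mul]
      rw [hH]; abel
    · rw [det_fromBlocks_zero₂₁, det_fromBlocks_zero₁₂, hdet, det_one]; ring
    · rintro i ((j|j)|j)
      · simpa using hUd i j
      · simpa using totalDegree_one_apply_le (σ := σ) i j
      · simpa using totalDegree_one_apply_le (σ := σ) i j
    · rintro i ((j|j)|j) s
      · simpa using hUc i j s
      · simpa using abs_coeff_one_apply_le (σ := σ) i j s
      · simpa using abs_coeff_one_apply_le (σ := σ) i j s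
    · rintro ((i|i)|i) j
      · simpa using hVd i j
      · simp
      · simpa using (h₀d i j).trans (hd i j)
    · rintro ((i|i)|i) j s
      · simpa using hVc i j s
      · simp
      · simpa [h₀c] using abs_emod_two_le ((H i j).coeff s)
    · rintro ((i|i)|i) ((j|j)|j)
      · simpa using hDd i j
      · simp
      · simp
      · simpa [totalDegree_neg] using hUd i j
      · simpa using totalDegree_one_apply_le (σ := σ) i j
      · simp
      · simp
      · simp
      · simpa using totalDegree_one_apply_le (σ := σ) i j
    · rintro ((i|i)|i) ((j|j)|j) s
      · simpa using hDc i j s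
      · simp
      · simp
      · simpa [coeff_neg] using hUc i j s
      · simpa using abs_coeff_one_apply_le (σ := σ) i j s
      · simp
      · simp
      · simp
      · simpa using abs_coeff_one_apply_le (σ := σ) i j s

end HeightToSizeProof

open HeightToSizeProof in
/-- **Height is free up to size** (item `stmt-ValiantsHypothesis-7681`, route `IntegralOrbits`),
with the absolute constant `c = 2`: an `m × m` affine determinantal expression over `ℤ` in the
variables `σ` with all coefficients bounded by `2 ^ h` can be replaced by one of size
`m' = 2m(h+1) ≤ (m + #σ + h + 2) ^ 2` with all coefficients in `{-1, 0, 1}` and the same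
determinant. -/
theorem heightToSize_proof :
    Summit.ValiantsHypothesis.ValiantsHypothesis.Theses.IntegralOrbits.HeightToSize := by
  unfold Summit.ValiantsHypothesis.ValiantsHypothesis.Theses.IntegralOrbits.HeightToSize
  refine ⟨2, ?_⟩
  intro σ _ _ m h f A hdeg hcoeff hdet
  obtain ⟨ι, _, _, X, U, V, D, hcard, hXD, hXV, hD, hUd, hUc, hVd, hVc, hDd, hDc⟩ :=
    exists_gadget h A hdeg hcoeff
  have hmul : Matrix.fromBlocks 1 X 0 1 * Matrix.fromBlocks A 0 (-V) D =
      Matrix.fromBlocks (0 : Matrix (Fin m) (Fin m) (MvPolynomial σ ℤ)) U (-V) D := by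
    rw [Matrix.fromBlocks_multiply]
    simp only [Matrix.one_mul, Matrix.zero_mul, Matrix.mul_zero, zero_add, Matrix.mul_neg, hXD,
      hXV, add_neg_cancel]
  have hB₀det : (Matrix.fromBlocks (0 : Matrix (Fin m) (Fin m) (MvPolynomial σ ℤ)) U (-V) D).det
      = f := by
    rw [← hmul, Matrix.det_mul, Matrix.det_fromBlocks_zero₂₁, Matrix.det_fromBlocks_zero₁₂,
      hD, hdet]
    simp
  have hB₀d : ∀ a b, ((Matrix.fromBlocks (0 : Matrix (Fin m) (Fin m) (MvPolynomial σ ℤ)) U (-V) D)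
      a b).totalDegree ≤ 1 := by
    rintro (a|a) (b|b)
    · simp
    · simpa using hUd a b
    · simpa [MvPolynomial.totalDegree_neg] using hVd a b
    · simpa using hDd a b
  have hB₀c : ∀ a b s, |((Matrix.fromBlocks (0 : Matrix (Fin m) (Fin m) (MvPolynomial σ ℤ)) U (-V)
      D) a b).coeff s| ≤ 1 := by
    rintro (a|a) (b|b) s
    · simp
    · simpa using hUc a b s
    · simpa [MvPolynomial.coeff_neg] using hVc a b s
    · simpa using hDc a b s
  let e : Fin m ⊕ ι ≃ Fin (m + Fintype.card ι) :=
    (Equiv.sumCongr (Equiv.refl _) (Fintype.equivFin ι)).trans finSumFinEquiv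
  refine ⟨m + Fintype.card ι, Matrix.reindex e e
      (Matrix.fromBlocks (0 : Matrix (Fin m) (Fin m) (MvPolynomial σ ℤ)) U (-V) D),
    ?_, fun i j => ?_, fun i j s => ?_, ?_⟩
  · rw [hcard, Fintype.card_fin]
    nlinarith [Nat.zero_le (Fintype.card σ), Nat.zero_le m, Nat.zero_le h]
  · simp only [Matrix.reindex_apply, Matrix.submatrix_apply]
    exact hB₀d _ _
  · simp only [Matrix.reindex_apply, Matrix.submatrix_apply]
    exact hB₀c _ _ _
  · rw [Matrix.det_reindex_self, hB₀det]

end Summit.ValiantsHypothesis.ValiantsHypothesis.Theorems
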